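import Literature.Algebra.EuclideanLattices.SmoothingGaussianExpectations
import Literature.Probability.Moments.IndependentVectorSumsTail
import Mathlib.Probability.HasLaw
import Mathlib.Analysis.Real.Pi.Bounds
import HarnessLib

/-!
# Micciancio–Regev 2007, proof of Thm. 5.9 (`IncGDD → SIS`): the conditional success probability `≥ 1/3` — proved

Topic `Algebra/EuclideanLattices` (family `pqc`); serves the decomposition of the named fact
`Literature.Computability.Cryptography.MicciancioRegev2007_gapCVP'_to_SIS'` (MR07 Thm. 5.23 proper,
`GapSVPToSIS.lean`), whose first step ("using Corollary 5.13 (with `F` as oracle), we obtain … `S`",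
authors' version p. 29) runs the reduction of **Thm. 5.9** (through Lemma 5.10, tree:
`MRShortVectorsIteration.lean`). Companion of `MRGapCVPWitness.lean` (the analogous per-sample
analysis of Thm. 5.23).

The last part of the proof of Thm. 5.9 (pp. 23–24): "we show the stronger fact that the success
probability of the reduction is at least `1/3` conditioned on any fixed values of `C`, the oracle query
`A`, and the answer `z = F(A)` for which `H` is satisfied … the vectors `yᵢ` are distributed
independently according to `D_{L(B),s,(cᵢ+tᵢ)}` … `‖s - t‖ ≤ ‖x - Cz‖ + ‖(C - Y)z - t‖ ≤ ‖S‖/g +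
‖(Y - (C+T))z‖` … by Lemma 4.3 and Lemma 2.11, `Exp‖(Y - (C+T))z‖² ≤ (1/(2π) + ε/(1-ε) + (ε/(1-ε))²m)
‖z‖² s² n ≤ ‖z‖² s² n/6` for all sufficiently large `n` … `≤ (2/3) r²` using `‖z‖ ≤ β`, `s = 2r/γ`,
`γ = β√n` … by Markov … `Pr{‖(Y - (C+T))z‖ > r} ≤ 2/3`." In Mathlib's language (a probability space
`(Ω, P)`, independent `yᵢ : Ω → Λ` with `HasLaw (yᵢ) D_{Λ,s,c'ᵢ}`, `c'ᵢ = cᵢ + tᵢ`, a fixed integer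
vector `z`):

* `MicciancioRegev2007.integral_norm_sq_sum_smul_coe_sub_le` — Lemma 4.3 (tree:
  `integral_discreteGaussian_norm_sub_sq_le`, `norm_integral_discreteGaussian_coe_sub_sq_le`) fed into
  Lemma 2.11 (tree: `Literature.Probability.Moments.MicciancioRegev2007.integral_norm_sq_sum_smul_le`):
  `E‖∑ᵢ zᵢ(yᵢ - c'ᵢ)‖² ≤ ((1/(2π) + ε/(1-ε)) s²n + (ε/(1-ε))² s²n · m) ∑ᵢ zᵢ²` (`0 < ε < 1`, `2η_ε(Λ) ≤ s`).
* `MicciancioRegev2007.measureReal_lt_norm_sum_smul_coe_sub_le` — the Markov step with the printed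
  arithmetic: if `1/(2π) + ε/(1-ε) + (ε/(1-ε))²m ≤ 1/6`, `∑zᵢ² ≤ β²`, `s = 2r/(β√n)`, then
  `Pr[r < ‖∑ᵢ zᵢ(yᵢ - c'ᵢ)‖] ≤ 2/3`.
* `MicciancioRegev2007.norm_output_sub_le` — the triangle inequality
  `‖(x - Yz) - t‖ ≤ ‖x - Cz‖ + ‖∑ᵢ zᵢ(yᵢ - (cᵢ + tᵢ))‖` when `∑ᵢ zᵢ tᵢ = -t`, and
  `MicciancioRegev2007.measureReal_lt_norm_output_sub_le` — **the conditional success bound**: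
  `Pr[‖S‖/g + r < ‖s - t‖] ≤ 2/3` for the output `s = x - Yz` when `‖x - Cz‖ ≤ ‖S‖/g` (Lemma 5.8).
* `MicciancioRegev2007.eventually_side_condition_59` — "for all sufficiently large `n`": for `ε = 2⁻ⁿ`
  (the value used by Thm. 5.23 via Cor. 5.13) and polynomially many samples `m(n) ≤ n^d`, eventually
  `1/(2π) + ε/(1-ε) + (ε/(1-ε))² m(n) ≤ 1/6` (as `1/(2π) < 1/6`).

Theorems only; no definitions, no named facts.

## References

* D. Micciancio, O. Regev, *Worst-case to average-case reductions based on Gaussian measures*,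
  SIAM J. Comput. 37 (2007) 267–302; authors' version (`lit read doi:10.1137/S0097539705447360`),
  Thm. 5.9 and its proof, pp. 22–24 (the displays of p. 23 bottom – p. 24 top).
-/

noncomputable section

open MeasureTheory ProbabilityTheory Module Metric Finset Filter
open scoped Real InnerProductSpace Topology

namespace Literature.Algebra.EuclideanLattices

namespace MicciancioRegev2007

variable {V : Type*} [NormedAddCommGroup V] [InnerProductSpace ℝ V] [FiniteDimensional ℝ V]
  [MeasurableSpace V] [BorelSpace V]
variable (Λ : Submodule ℤ V) [DiscreteTopology Λ] [IsZLattice ℝ Λ]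
variable {Ω : Type*} [MeasurableSpace Ω] {P : Measure Ω} [IsProbabilityMeasure P]
variable {m : ℕ}

/-- `x ↦ x - c` is square integrable under `D_{Λ,s,c}` (`0 < s`; the Gaussian series `∑ ‖x - c‖² ρ_s(x - c)`
converges). [cite: MicciancioRegev2007, Lemma 4.3] -/
theorem memLp_two_coe_sub {s : ℝ} (hs : 0 < s) (c : V) :
    MemLp (fun x : Λ => (x : V) - c) 2 (discreteGaussian Λ s c).toMeasure := by
  refine (memLp_two_iff_integrable_sq_norm (measurable_of_countable _).aestronglyMeasurable).2 ?_
  refine integrable_toMeasure_of_summable _ ?_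
  simp_rw [discreteGaussian_toReal Λ hs c]
  have h := summable_norm_sq_mul_gaussianFunction_sub Λ hs c
  refine (h.div_const (∑' y : Λ, gaussianFunction s ((y : V) - c))).congr fun x => ?_
  rw [abs_of_nonneg (sq_nonneg _)]
  ring

/-- **MR07 Thm. 5.9, second-moment bound** (p. 24, first display): let `0 < ε < 1`, `0 < s`,
`2η_ε(Λ) ≤ s`, and let `y₁, …, y_m` be independent random vectors of `Λ` with `yᵢ ∼ D_{Λ,s,c'ᵢ}`
(`c'ᵢ = cᵢ + tᵢ`). Then for every integer vector `z`,
`E‖∑ᵢ zᵢ(yᵢ - c'ᵢ)‖² ≤ ((1/(2π) + ε/(1-ε)) s²n + (ε/(1-ε))² s²n · m) ∑ᵢ zᵢ²` — Lemma 4.3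
(`E‖yᵢ - c'ᵢ‖² ≤ (1/(2π) + ε/(1-ε)) s²n`, `‖E(yᵢ - c'ᵢ)‖² ≤ (ε/(1-ε))² s²n`) and Lemma 2.11.
[cite: MicciancioRegev2007, Thm. 5.9 (proof, pp. 23–24)] -/
theorem integral_norm_sq_sum_smul_coe_sub_le {ε s : ℝ} (hε : 0 < ε) (hε1 : ε < 1) (hs : 0 < s)
    (hηs : 2 * smoothingParameter Λ ε ≤ s) (c' : Fin m → V) {y : Fin m → Ω → Λ}
    (hind : iIndepFun y P)
    (hy : ∀ i, HasLaw (y i) (discreteGaussian Λ s (c' i)).toMeasure P) (z : Fin m → ℤ) :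
    ∫ ω, ‖∑ i, (z i : ℝ) • ((y i ω : V) - c' i)‖ ^ 2 ∂P ≤
      ((1 / (2 * π) + ε / (1 - ε)) * s ^ 2 * finrank ℝ V +
          (ε / (1 - ε)) ^ 2 * s ^ 2 * finrank ℝ V * m) * ∑ i, (z i : ℝ) ^ 2 := by
  set v : Fin m → Ω → V := fun i ω => (y i ω : V) - c' i with hv
  have hvind : iIndepFun v P :=
    hind.comp (fun i (x : Λ) => (x : V) - c' i) fun i => measurable_of_countable _
  have hvL2 : ∀ i, MemLp (v i) 2 P := fun i => by
    have h := memLp_two_coe_sub Λ hs (c' i)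
    rw [← (hy i).map_eq] at h
    exact h.comp_of_map (hy i).aemeasurable
  have hl : ∀ i, ∫ ω, ‖v i ω‖ ^ 2 ∂P ≤ (1 / (2 * π) + ε / (1 - ε)) * s ^ 2 * finrank ℝ V :=
    fun i => by
    have h := (hy i).integral_comp (f := fun x : Λ => ‖(x : V) - c' i‖ ^ 2)
      (measurable_of_countable _).aestronglyMeasurable
    have hI : ∫ ω, ‖v i ω‖ ^ 2 ∂P =
        ∫ x, ‖(x : V) - c' i‖ ^ 2 ∂(discreteGaussian Λ s (c' i)).toMeasure := h
    rw [hI]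
    exact integral_discreteGaussian_norm_sub_sq_le Λ hε hε1 hs hηs (c' i)
  have hε' : ∀ i, ‖∫ ω, v i ω ∂P‖ ^ 2 ≤ (ε / (1 - ε)) ^ 2 * s ^ 2 * finrank ℝ V := fun i => by
    have h := (hy i).integral_comp (f := fun x : Λ => (x : V) - c' i)
      (measurable_of_countable _).aestronglyMeasurable
    have hI : ∫ ω, v i ω ∂P = ∫ x, ((x : V) - c' i) ∂(discreteGaussian Λ s (c' i)).toMeasure := h
    rw [hI]
    exact norm_integral_discreteGaussian_coe_sub_sq_le Λ hε hε1 hs hηs (c' i)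
  have h211 := Literature.Probability.Moments.MicciancioRegev2007.integral_norm_sq_sum_smul_le
    hvind hvL2 hl hε' (fun i => (z i : ℝ))
  simpa [hv] using h211

/-- **MR07 Thm. 5.9, the Markov step with the printed arithmetic** (p. 24): under the hypotheses of
`integral_norm_sq_sum_smul_coe_sub_le`, if moreover `1/(2π) + ε/(1-ε) + (ε/(1-ε))² m ≤ 1/6` ("for all
sufficiently large `n`"), `∑ᵢ zᵢ² ≤ β²` (`‖z‖ ≤ β`), `0 < β`, `0 < r`, `n ≥ 1` and `s = 2r/γ` with
`γ = β√n`, then `Pr[r < ‖∑ᵢ zᵢ(yᵢ - c'ᵢ)‖] ≤ 2/3`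
("`Exp[‖(Y - (C+T))z‖²] ≤ ‖z‖²s²n/6 ≤ (2/3) r²` and, by Markov inequality, `≤ 2/3`").
[cite: MicciancioRegev2007, Thm. 5.9 (proof, p. 24)] -/
theorem measureReal_lt_norm_sum_smul_coe_sub_le {ε β r : ℝ} (hε : 0 < ε) (hε1 : ε < 1)
    (hβ : 0 < β) (hr : 0 < r) (hn : 1 ≤ finrank ℝ V)
    (hηs : 2 * smoothingParameter Λ ε ≤ 2 * r / (β * Real.sqrt (finrank ℝ V))) (c' : Fin m → V)
    {y : Fin m → Ω → Λ} (hind : iIndepFun y P)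
    (hy : ∀ i, HasLaw (y i)
      (discreteGaussian Λ (2 * r / (β * Real.sqrt (finrank ℝ V))) (c' i)).toMeasure P)
    {z : Fin m → ℤ} (hz : ∑ i, (z i : ℝ) ^ 2 ≤ β ^ 2)
    (hnum : 1 / (2 * π) + ε / (1 - ε) + (ε / (1 - ε)) ^ 2 * m ≤ 1 / 6) :
    P.real {ω | r < ‖∑ i, (z i : ℝ) • ((y i ω : V) - c' i)‖} ≤ 2 / 3 := by
  set n : ℕ := finrank ℝ V with hn_def
  set s : ℝ := 2 * r / (β * Real.sqrt n) with hs_def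
  have hsq : 0 < Real.sqrt n := Real.sqrt_pos.2 (by exact_mod_cast hn)
  have hs : 0 < s := by rw [hs_def]; positivity
  set v : Fin m → Ω → V := fun i ω => (y i ω : V) - c' i with hv
  have hvind : iIndepFun v P :=
    hind.comp (fun i (x : Λ) => (x : V) - c' i) fun i => measurable_of_countable _
  have hvL2 : ∀ i, MemLp (v i) 2 P := fun i => by
    have h := memLp_two_coe_sub Λ hs (c' i)
    rw [← (hy i).map_eq] at h
    exact h.comp_of_map (hy i).aemeasurable
  have hl : ∀ i, ∫ ω, ‖v i ω‖ ^ 2 ∂P ≤ (1 / (2 * π) + ε / (1 - ε)) * s ^ 2 * n := fun i => by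
    have h := (hy i).integral_comp (f := fun x : Λ => ‖(x : V) - c' i‖ ^ 2)
      (measurable_of_countable _).aestronglyMeasurable
    have hI : ∫ ω, ‖v i ω‖ ^ 2 ∂P =
        ∫ x, ‖(x : V) - c' i‖ ^ 2 ∂(discreteGaussian Λ s (c' i)).toMeasure := h
    rw [hI]
    exact integral_discreteGaussian_norm_sub_sq_le Λ hε hε1 hs hηs (c' i)
  have hε' : ∀ i, ‖∫ ω, v i ω ∂P‖ ^ 2 ≤ (ε / (1 - ε)) ^ 2 * s ^ 2 * n := fun i => by
    have h := (hy i).integral_comp (f := fun x : Λ => (x : V) - c' i)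
      (measurable_of_countable _).aestronglyMeasurable
    have hI : ∫ ω, v i ω ∂P = ∫ x, ((x : V) - c' i) ∂(discreteGaussian Λ s (c' i)).toMeasure := h
    rw [hI]
    exact norm_integral_discreteGaussian_coe_sub_sq_le Λ hε hε1 hs hηs (c' i)
  -- the printed arithmetic: `(l + ε' m) ‖z‖² ≤ ‖z‖² s² n / 6 ≤ β² s² n / 6 = (2/3) r²`
  have hθ : ((1 / (2 * π) + ε / (1 - ε)) * s ^ 2 * n + (ε / (1 - ε)) ^ 2 * s ^ 2 * n * m) *
      (∑ i, (z i : ℝ) ^ 2) ≤ 2 / 3 * r ^ 2 := by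
    have hzs : 0 ≤ ∑ i, (z i : ℝ) ^ 2 := Finset.sum_nonneg fun i _ => sq_nonneg _
    have hcoef : (1 / (2 * π) + ε / (1 - ε)) * s ^ 2 * n + (ε / (1 - ε)) ^ 2 * s ^ 2 * n * m =
        s ^ 2 * n * (1 / (2 * π) + ε / (1 - ε) + (ε / (1 - ε)) ^ 2 * m) := by ring
    have hsn : s ^ 2 * n * β ^ 2 = 4 * r ^ 2 := by
      have hn0 : (0 : ℝ) < n := by exact_mod_cast hn
      have hsq2 : Real.sqrt n ^ 2 = (n : ℝ) := Real.sq_sqrt hn0.le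
      rw [hs_def, div_pow, mul_pow, mul_pow, hsq2, div_mul_eq_mul_div, div_mul_eq_mul_div,
        div_eq_iff (by positivity)]
      ring
    rw [hcoef]
    calc s ^ 2 * n * (1 / (2 * π) + ε / (1 - ε) + (ε / (1 - ε)) ^ 2 * m) * ∑ i, (z i : ℝ) ^ 2
        ≤ s ^ 2 * n * (1 / 6) * β ^ 2 :=
          mul_le_mul (mul_le_mul_of_nonneg_left hnum (by positivity)) hz hzs (by positivity)
      _ = 2 / 3 * r ^ 2 := by linear_combination (1 / 6) * hsn
  exact Literature.Probability.Moments.MicciancioRegev2007.measureReal_lt_norm_sum_smul_le_of_le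
    hvind hvL2 hl hε' (fun i => (z i : ℝ)) hr hθ

/-! ### The output `s = x - Yz` and its distance from `t` -/

omit [FiniteDimensional ℝ V] [MeasurableSpace V] [BorelSpace V] in
/-- **The triangle inequality of the proof of Thm. 5.9** (p. 23: "`‖s - t‖ ≤ ‖x - Cz‖ + ‖(C - Y)z - t‖
≤ ‖S‖/g + ‖(Y - (C+T))z‖`", using `Tz = -t`): if `∑ᵢ zᵢ tᵢ = -t` then
`‖(x - ∑ᵢ zᵢyᵢ) - t‖ ≤ ‖x - ∑ᵢ zᵢcᵢ‖ + ‖∑ᵢ zᵢ(yᵢ - (cᵢ + tᵢ))‖`.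
[cite: MicciancioRegev2007, Thm. 5.9 (proof, p. 23)] -/
theorem norm_output_sub_le (x t : V) (c tv yv : Fin m → V) (z : Fin m → ℤ)
    (hT : ∑ i, (z i : ℝ) • tv i = -t) :
    ‖(x - ∑ i, (z i : ℝ) • yv i) - t‖ ≤
      ‖x - ∑ i, (z i : ℝ) • c i‖ + ‖∑ i, (z i : ℝ) • (yv i - (c i + tv i))‖ := by
  have hid : (x - ∑ i, (z i : ℝ) • yv i) - t =
      (x - ∑ i, (z i : ℝ) • c i) - ∑ i, (z i : ℝ) • (yv i - (c i + tv i)) := by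
    have hsum : ∑ i, (z i : ℝ) • (yv i - (c i + tv i)) =
        ∑ i, (z i : ℝ) • yv i - ∑ i, (z i : ℝ) • c i - ∑ i, (z i : ℝ) • tv i := by
      simp only [smul_sub, smul_add, Finset.sum_sub_distrib, Finset.sum_add_distrib]
      abel
    rw [hsum, hT]
    abel
  rw [hid]
  exact norm_sub_le _ _

/-- **MR07 Thm. 5.9, conditional success probability `≥ 1/3`** (pp. 23–24): in the setting of
`measureReal_lt_norm_sum_smul_coe_sub_le` (fixed `C`, `A`, `z` with `H`; `yᵢ ∼ D_{Λ,s,cᵢ+tᵢ}`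
independent, `s = 2r/(β√n)`, `‖z‖ ≤ β`, the side condition), if the fixed vector `x` of the combining
procedure satisfies `‖x - Cz‖ ≤ ‖S‖/g` (Lemma 5.8 with `q ≥ g n√m β`; any bound `b`) and `Tz = -t`, then
the output `s = x - Yz` has `Pr[b + r < ‖s - t‖] ≤ 2/3` — "the conditional probability of
`‖s - t‖ ≤ ‖S‖/g + r` is at least `1/3`". [cite: MicciancioRegev2007, Thm. 5.9 (proof, pp. 23–24)] -/
theorem measureReal_lt_norm_output_sub_le {ε β r b : ℝ} (hε : 0 < ε) (hε1 : ε < 1)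
    (hβ : 0 < β) (hr : 0 < r) (hn : 1 ≤ finrank ℝ V)
    (hηs : 2 * smoothingParameter Λ ε ≤ 2 * r / (β * Real.sqrt (finrank ℝ V))) (c tv : Fin m → V)
    {y : Fin m → Ω → Λ} (hind : iIndepFun y P)
    (hy : ∀ i, HasLaw (y i)
      (discreteGaussian Λ (2 * r / (β * Real.sqrt (finrank ℝ V))) (c i + tv i)).toMeasure P)
    {z : Fin m → ℤ} (hz : ∑ i, (z i : ℝ) ^ 2 ≤ β ^ 2)
    (hnum : 1 / (2 * π) + ε / (1 - ε) + (ε / (1 - ε)) ^ 2 * m ≤ 1 / 6)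
    {x t : V} (hx : ‖x - ∑ i, (z i : ℝ) • c i‖ ≤ b) (hT : ∑ i, (z i : ℝ) • tv i = -t) :
    P.real {ω | b + r < ‖(x - ∑ i, (z i : ℝ) • (y i ω : V)) - t‖} ≤ 2 / 3 := by
  refine le_trans (measureReal_mono (fun ω hω => ?_))
    (measureReal_lt_norm_sum_smul_coe_sub_le Λ hε hε1 hβ hr hn hηs (fun i => c i + tv i) hind
      hy hz hnum)
  simp only [Set.mem_setOf_eq] at hω ⊢
  have h := norm_output_sub_le x t c tv (fun i => (y i ω : V)) z hT
  linarith

/-! ### "for all sufficiently large `n`" -/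

/-- **The side condition of Thm. 5.9 eventually holds** (p. 24: "`≤ ‖z‖²s²n/6` for all sufficiently
large `n`"): with `ε = 2⁻ⁿ` (the value at which Thm. 5.23 invokes Cor. 5.13) and `m(n) ≤ n^d`
eventually, `1/(2π) + ε/(1-ε) + (ε/(1-ε))² m(n) ≤ 1/6` eventually, because `1/(2π) < 1/6` (`π > 3`) and
the other two terms tend to `0`. [cite: MicciancioRegev2007, Thm. 5.9 (proof, p. 24)] -/
theorem eventually_side_condition_59 {mf : ℕ → ℕ} {d : ℕ} (hm : ∀ᶠ n : ℕ in atTop, mf n ≤ n ^ d) :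
    ∀ᶠ n : ℕ in atTop, 1 / (2 * π) + (2⁻¹ : ℝ) ^ n / (1 - (2⁻¹ : ℝ) ^ n) +
        ((2⁻¹ : ℝ) ^ n / (1 - (2⁻¹ : ℝ) ^ n)) ^ 2 * mf n ≤ 1 / 6 := by
  -- the gap `1/6 - 1/(2π) > 0`
  have hgap : 0 < 1 / 6 - 1 / (2 * π) := by
    have hπ : 1 / (2 * π) < 1 / 6 := by
      rw [div_lt_div_iff₀ (by positivity) (by norm_num)]
      linarith [Real.pi_gt_three]
    linarith
  set g : ℝ := 1 / 6 - 1 / (2 * π) with hg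
  -- `ε → 0` and `ε² n^d → 0` along `ε = 2⁻ⁿ`
  have hε0 : Tendsto (fun n : ℕ => (2⁻¹ : ℝ) ^ n) atTop (𝓝 0) :=
    tendsto_pow_atTop_nhds_zero_of_lt_one (by norm_num) (by norm_num)
  have hε2 : Tendsto (fun n : ℕ => ((2⁻¹ : ℝ) ^ n) ^ 2 * (n : ℝ) ^ d) atTop (𝓝 0) := by
    have h := tendsto_pow_const_div_const_pow_of_one_lt d (by norm_num : (1 : ℝ) < 4)
    refine h.congr' (Eventually.of_forall fun n => ?_)
    have h4 : ((2⁻¹ : ℝ) ^ n) ^ 2 = (4 ^ n)⁻¹ := by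
      rw [← pow_mul, mul_comm, pow_mul, ← inv_pow]
      norm_num
    beta_reduce
    rw [h4, div_eq_mul_inv, mul_comm]
  have h1 : ∀ᶠ n : ℕ in atTop, (2⁻¹ : ℝ) ^ n ≤ g / 4 := hε0.eventually (ge_mem_nhds (by positivity))
  have h2 : ∀ᶠ n : ℕ in atTop, ((2⁻¹ : ℝ) ^ n) ^ 2 * (n : ℝ) ^ d ≤ g / 8 :=
    hε2.eventually (ge_mem_nhds (by positivity))
  filter_upwards [hm, h1, h2, eventually_ge_atTop 1] with n hmn h1n h2n hn1
  set ε : ℝ := (2⁻¹ : ℝ) ^ n with hεdef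
  have hεpos : 0 < ε := by positivity
  have hεhalf : ε ≤ 1 / 2 := by
    calc ε = (2⁻¹ : ℝ) ^ n := rfl
      _ ≤ (2⁻¹ : ℝ) ^ 1 := pow_le_pow_of_le_one (by norm_num) (by norm_num) hn1
      _ = 1 / 2 := by norm_num
  have h1ε : 1 / 2 ≤ 1 - ε := by linarith
  have hfrac : ε / (1 - ε) ≤ 2 * ε := by
    rw [div_le_iff₀ (by linarith)]
    nlinarith
  have hfrac0 : 0 ≤ ε / (1 - ε) := div_nonneg hεpos.le (by linarith)
  have hmR : (mf n : ℝ) ≤ (n : ℝ) ^ d := by exact_mod_cast hmn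
  have hsq : (ε / (1 - ε)) ^ 2 * mf n ≤ 4 * (ε ^ 2 * (n : ℝ) ^ d) := by
    calc (ε / (1 - ε)) ^ 2 * mf n ≤ (2 * ε) ^ 2 * (n : ℝ) ^ d := by gcongr
      _ = 4 * (ε ^ 2 * (n : ℝ) ^ d) := by ring
  have : 1 / (2 * π) + ε / (1 - ε) + (ε / (1 - ε)) ^ 2 * mf n ≤ 1 / (2 * π) + 2 * (g / 4) + 4 * (g / 8) := by
    linarith
  rw [hg] at this
  linarith

end MicciancioRegev2007

end Literature.Algebra.EuclideanLattices

end
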